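import Literature.AlgebraicGeometry.Morphisms.CechH1AffineProofs
import Literature.AlgebraicGeometry.Morphisms.CechH1Leray
import Literature.AlgebraicGeometry.Morphisms.CechH1ProjectiveFinite
import HarnessLib

/-!
# Finiteness of `Ȟ¹(𝒱, 𝒪_X)` passes from one affine covering to every covering; projective schemes

For a scheme `f : X → Spec A` over a Noetherian ring `A`, `Morphisms/CechH1` defines the Čech cohomology
`Ȟ¹(𝒱, 𝒪_X) = CechH1 f V` of the structure sheaf for an arbitrary family of opens `V`. This file proves:

* `moduleFinite_cechH1_of_affine_cover` — **if `Ȟ¹(𝒮, 𝒪_X)` is a finitely generated `A`-module for ONE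
  covering `𝒮 = (S_i)` of `X` by affine opens, then `Ȟ¹(𝒱, 𝒪_X)` is finitely generated for EVERY open
  covering `𝒱` of `X`** (any index type, members not necessarily affine or finitely many). Proof: let `𝒲`
  be the common refinement of `𝒮` and `𝒱` by affine opens (affine opens form a basis, Mathlib
  `Scheme.isBasis_affineOpens`); the refinement map `Ȟ¹(𝒮) → Ȟ¹(𝒲)` is surjective by Leray's acyclicity
  argument in degree one (`cechRefineH1_surjective`, `Morphisms/CechH1Leray`; Görtz–Wedhorn II,
  Cor. 21.82) fed with the vanishing of `Ȟ¹` of `𝒪` on the affine opens `S_i`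
  (`cechH1_affine_vanishing_holds`, `Morphisms/CechH1AffineProofs`; Görtz–Wedhorn II, Lemma 22.1), and
  `Ȟ¹(𝒱) → Ȟ¹(𝒲)` is injective (`cechRefineH1_injective`, `Morphisms/CechH1Refinement`; Cor. 21.81);
  over a Noetherian ring a submodule of a quotient of a finite module is finite. This is the
  covering-independence half of "Čech cohomology of an affine covering of a separated scheme computes
  `H¹`" (Görtz–Wedhorn II, Thm. 22.9; The Stacks Project, Tag 01XD) in the only form finiteness
  statements need, and it holds without separatedness.
* `ProjCech.moduleFinite_cechH1_of_iSup_eq_top` — hence, by Serre's finiteness theorem for the standard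
  covering (`ProjCech.moduleFinite_cechH1`, `Morphisms/CechH1ProjectiveFinite`; Hartshorne III
  Thm. 5.2 (a)), **`Ȟ¹(𝒱, 𝒪_Z)` is a finitely generated `A`-module for every open covering `𝒱` of a
  closed subscheme `Z ⊆ 𝐏^r_A`**, `A` Noetherian; `moduleFinite_cechH1_of_isClosedImmersion` is the same
  for an arbitrary structure morphism `g : Z → Spec A` factoring through the closed immersion, and
  `moduleFinite_cechH1_preimageFamily` the case `𝒱 = π⁻¹𝒰` of the preimage of an open covering of
  another scheme `X` under any morphism `π : Z → X` — the input "`H¹(X, π_* 𝒪_{Z'})` is finite" of the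
  Chow-lemma step in the proof of the finiteness of `H¹(X, 𝒪_X)` for proper `X` (Görtz–Wedhorn II,
  Thm. 23.17, proof, p. 425; The Stacks Project, Tag 02O5), i.e. of the named fact
  `Literature.AlgebraicGeometry.Morphisms.cechH1_finite`.
* `cechH1_finite_of_exists_affine_cover` — consequently the named fact `cechH1_finite` (stated for all
  finite affine coverings) already follows from the finiteness of `Ȟ¹` for SOME affine covering of each
  proper `X → Spec A`.

Everything is proved; no named facts are introduced. Mathlib searched (pin v4.32):
`Scheme.isBasis_affineOpens`, `Opens.isBasis_iff_nbhd`, `Module.Finite.of_surjective`,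
`Module.Finite.of_injective`, `isNoetherian_of_isNoetherianRing_of_finite`, `Scheme.Hom.preimage_iSup`
(used); Mathlib has no Čech cohomology of schemes.

## References

* U. Görtz, T. Wedhorn, *Algebraic Geometry II: Cohomology of Schemes*, Springer Spektrum (2023),
  doi:10.1007/978-3-658-43031-3: Cor. 21.81 and Cor. 21.82, p. 265; Lemma 22.1, p. 327; Thm. 22.9,
  p. 332; Thm. 23.17 and its proof, Cor. 23.18, pp. 424–425 (read via the held copy). [GortzWedhorn2023]
* R. Hartshorne, *Algebraic Geometry*, GTM 52, Springer (1977): III Thm. 4.5, III Thm. 5.2 (a).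
  [Hartshorne1977]
* The Stacks Project, Tags 01XD, 03F7, 02O5. [StacksProject]
-/

noncomputable section

open CategoryTheory AlgebraicGeometry Limits TopologicalSpace Opposite

universe u v w

namespace Literature.AlgebraicGeometry.Morphisms

variable {A : Type u} [CommRing A]

section AnyCover

variable {X : Scheme.{u}} (f : X ⟶ Spec (.of A)) {ι : Type v} {κ : Type w} (S : ι → X.Opens)
  (V : κ → X.Opens)

/-- **Finiteness of `Ȟ¹(𝒱, 𝒪_X)` for every open covering from one affine covering.** Let `X → Spec A`
be a scheme over a Noetherian ring `A` and `𝒮 = (S_i)` a covering of `X` by affine opens with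
`Ȟ¹(𝒮, 𝒪_X)` a finitely generated `A`-module. Then `Ȟ¹(𝒱, 𝒪_X)` is finitely generated for every open
covering `𝒱` of `X`: with `𝒲` the common refinement of `𝒮` and `𝒱` by affine opens,
`Ȟ¹(𝒮) ↠ Ȟ¹(𝒲)` (Leray, Görtz–Wedhorn II Cor. 21.82, using `Ȟ¹ = 0` for `𝒪` on the affine `S_i`,
Lemma 22.1) and `Ȟ¹(𝒱) ↪ Ȟ¹(𝒲)` (Cor. 21.81).
[cite: GortzWedhorn2023, Cor. 21.81 and Cor. 21.82 (p. 265) with Lemma 22.1 (p. 327)] -/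
theorem moduleFinite_cechH1_of_affine_cover [IsNoetherianRing A] (hS : ∀ i, IsAffineOpen (S i))
    (hScov : ⨆ i, S i = ⊤) [Module.Finite A (CechH1 f S)] (hVcov : ⨆ b, V b = ⊤) :
    Module.Finite A (CechH1 f V) := by
  classical
  -- the common refinement `𝒲` of `𝒮` and `𝒱` by affine opens
  let J : Type u := {W : X.Opens // IsAffineOpen W ∧ (∃ i, W ≤ S i) ∧ ∃ b, W ≤ V b}
  let W : J → X.Opens := fun j => j.1
  have hWS : ∀ j : J, ∃ i, W j ≤ S i := fun j => j.2.2.1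
  have hWV : ∀ j : J, ∃ b, W j ≤ V b := fun j => j.2.2.2
  choose τS hτS using hWS
  choose τV hτV using hWV
  -- `𝒲` covers `X`, affine opens being a basis of the topology
  have hWcov : ⨆ j, W j = ⊤ := by
    refine le_antisymm le_top ?_
    intro x _
    have hxS : x ∈ ⨆ i, S i := by rw [hScov]; trivial
    have hxV : x ∈ ⨆ b, V b := by rw [hVcov]; trivial
    obtain ⟨i, hi⟩ := Opens.mem_iSup.mp hxS
    obtain ⟨b, hb⟩ := Opens.mem_iSup.mp hxV
    obtain ⟨W', hW', hxW', hW'le⟩ :=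
      Opens.isBasis_iff_nbhd.mp X.isBasis_affineOpens (show x ∈ S i ⊓ V b from ⟨hi, hb⟩)
    exact Opens.mem_iSup.mpr
      ⟨⟨W', hW', ⟨i, hW'le.trans inf_le_left⟩, ⟨b, hW'le.trans inf_le_right⟩⟩, hxW'⟩
  have hle : ∀ U : X.Opens, U ≤ ⨆ j, W j := fun U => by rw [hWcov]; exact le_top
  -- `Ȟ¹(𝒮) → Ȟ¹(𝒲)` is surjective: Leray in degree one, the `S_i` being affine
  have hsurj : Function.Surjective (cechRefineH1 f S W τS hτS) :=
    cechRefineH1_surjective f S W τS hτS (fun i => hle (S i)) fun i =>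
      cechH1_affine_vanishing_holds f (hS i) (fun j => S i ⊓ W j)
        (by rw [← inf_iSup_eq, hWcov, inf_top_eq])
  haveI : Module.Finite A (CechH1 f W) := Module.Finite.of_surjective _ hsurj
  haveI : IsNoetherian A (CechH1 f W) := isNoetherian_of_isNoetherianRing_of_finite A _
  -- `Ȟ¹(𝒱) → Ȟ¹(𝒲)` is injective
  exact Module.Finite.of_injective (cechRefineH1 f V W τV hτV)
    (cechRefineH1_injective f V W τV hτV fun b => hle (V b))

/-- The same along a morphism: if `Ȟ¹(𝒮, 𝒪_X)` is finitely generated for one affine covering `𝒮` of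
`X`, then `Ȟ¹(π⁻¹𝒰, 𝒪_X)` is finitely generated for the preimage of every open covering `𝒰` of a scheme
`Y` under any morphism `π : X → Y` (this is `Ȟ¹(𝒰, π_* 𝒪_X)`). [folklore] -/
theorem moduleFinite_cechH1_preimageFamily_of_affine_cover [IsNoetherianRing A]
    (hS : ∀ i, IsAffineOpen (S i)) (hScov : ⨆ i, S i = ⊤) [Module.Finite A (CechH1 f S)]
    {Y : Scheme.{u}} (π : X ⟶ Y) (U : κ → Y.Opens) (hU : ⨆ b, U b = ⊤) :
    Module.Finite A (CechH1 f (preimageFamily π U)) :=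
  moduleFinite_cechH1_of_affine_cover f S (preimageFamily π U) hS hScov
    (by
      change ⨆ b, π ⁻¹ᵁ U b = ⊤
      rw [← Scheme.Hom.preimage_iSup, hU, Scheme.Hom.preimage_top])

end AnyCover

/-! ## Projective schemes over a Noetherian ring -/

namespace ProjCech

variable {r : ℕ} {Z : Scheme.{u}} (ι : Z ⟶ PP A r) [IsClosedImmersion ι]

/-- **`Ȟ¹(𝒱, 𝒪_Z)` is a finitely generated `A`-module for every open covering `𝒱` of a closed
subscheme `ι : Z ↪ 𝐏^r_A` over a Noetherian ring `A`** (Hartshorne III Thm. 5.2 (a) for `𝓕 = 𝒪_Z`,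
`i = 1`: the standard affine covering `Z ∩ D₊(x_i)` has finitely generated `Ȟ¹` by Serre's theorem,
`ProjCech.moduleFinite_cechH1`, and finiteness passes to every covering,
`moduleFinite_cechH1_of_affine_cover`). [cite: Hartshorne1977, III Thm. 5.2 (a) p. 228 (PDF p. 284)] -/
theorem moduleFinite_cechH1_of_iSup_eq_top [IsNoetherianRing A] {κ : Type v} (V : κ → Z.Opens)
    (hV : ⨆ b, V b = ⊤) : Module.Finite A (CechH1 (strZ ι) V) :=
  haveI := moduleFinite_cechH1 ι
  moduleFinite_cechH1_of_affine_cover (strZ ι) (cover ι) V (isAffineOpen_cover ι)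
    (iSup_cover_eq_top ι) hV

end ProjCech

section Projective

variable {Z : Scheme.{u}} (g : Z ⟶ Spec (.of A)) {r : ℕ} (ι : Z ⟶ ProjCech.PP A r)
  [IsClosedImmersion ι] (hg : ι ≫ ProjCech.toSpec A r = g)

include hg

/-- `Ȟ¹(𝒱, 𝒪_Z)` is a finitely generated `A`-module for every open covering `𝒱` of an `A`-scheme
`g : Z → Spec A` (`A` Noetherian) admitting a closed `A`-immersion `ι : Z ↪ 𝐏^r_A`
(`ι ≫ (𝐏^r_A → Spec A) = g`). [cite: Hartshorne1977, III Thm. 5.2 (a) p. 228 (PDF p. 284)] -/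
theorem moduleFinite_cechH1_of_isClosedImmersion [IsNoetherianRing A] {κ : Type v} (V : κ → Z.Opens)
    (hV : ⨆ b, V b = ⊤) : Module.Finite A (CechH1 g V) := by
  subst hg
  exact ProjCech.moduleFinite_cechH1_of_iSup_eq_top ι V hV

/-- **The Chow-lemma input of the finiteness theorem.** For a projective `A`-scheme `Z` as above, any
morphism `π : Z → X` and any open covering `𝒰` of `X`, `Ȟ¹(π⁻¹𝒰, 𝒪_Z)` — the Čech cohomology
`Ȟ¹(𝒰, π_* 𝒪_Z)` — is a finitely generated `A`-module (the term `H¹(X, π_*𝒢')`, `𝒢' = 𝒪_{X'}`, in the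
proof of Görtz–Wedhorn II, Thm. 23.17, for the projective modification `π : X' → X` given by Chow's
lemma). [cite: GortzWedhorn2023, Thm. 23.17 proof (p. 425)] -/
theorem moduleFinite_cechH1_preimageFamily [IsNoetherianRing A] {X : Scheme.{u}} (π : Z ⟶ X)
    {κ : Type v} (U : κ → X.Opens) (hU : ⨆ b, U b = ⊤) :
    Module.Finite A (CechH1 g (preimageFamily π U)) :=
  moduleFinite_cechH1_of_isClosedImmersion g ι hg _
    (by
      change ⨆ b, π ⁻¹ᵁ U b = ⊤
      rw [← Scheme.Hom.preimage_iSup, hU, Scheme.Hom.preimage_top])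

end Projective

/-! ## The named fact follows from its one-covering form -/

/-- The named fact `cechH1_finite` (finiteness of `Ȟ¹(𝒰, 𝒪_X)` for ALL finite affine coverings of a
proper `X → Spec A`, `A` Noetherian) follows as soon as each such `X` has SOME affine covering with
finitely generated `Ȟ¹` (`moduleFinite_cechH1_of_affine_cover`). [folklore] -/
theorem cechH1_finite_of_exists_affine_cover
    (h : ∀ ⦃A : Type u⦄ [CommRing A] [IsNoetherianRing A] ⦃X : Scheme.{u}⦄ (f : X ⟶ Spec (.of A))
      [IsProper f], ∃ (ι : Type u) (S : ι → X.Opens), (∀ i, IsAffineOpen (S i)) ∧ ⨆ i, S i = ⊤ ∧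
        Module.Finite A (CechH1 f S)) :
    cechH1_finite.{u} := by
  intro A _ _ X f _ ι _ U _ hUcov
  obtain ⟨ι', S, hS, hScov, hfin⟩ := h f
  haveI := hfin
  exact moduleFinite_cechH1_of_affine_cover f S U hS hScov hUcov

end Literature.AlgebraicGeometry.Morphisms

end
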